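import Literature.NumberTheory.Sieve.MatomakiRadziwillProp1Ej
import Literature.NumberTheory.Sieve.BrunTitchmarshShortInterval
import Literature.NumberTheory.LFunctions.MertensTail
import HarnessLib

/-!
# Matomäki–Radziwiłł 2016, Proposition 1 — part (d1): Lemma 12 on `𝒰` and its sieve term (§8.3)

Topic `NumberTheory/Sieve`; fourth file of the assembly of `MatomakiRadziwill2016_prop1` (Proposition 1
of Matomäki–Radziwiłł, Ann. of Math. 183 (2016), §8), after `MatomakiRadziwillProp1Partition.lean`,
`MatomakiRadziwillProp1E1.lean`, `MatomakiRadziwillProp1Ej.lean`.  Everything is proved; no new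
definitions.

§8.3 of the paper begins: "We again apply Lemma 12, this time with `a_m = b_m = f(m) 1_𝒮(m)`,
`c_p = f(p)` and `P = exp((log X)^{1-1/48})`, `Q = exp(log X/(log log X))` and `H = (log X)^{1/48}` to
see that … the integral is bounded by
`H²(log X)² ∫_𝒰 |Q_{v,H} R_{v,H}|² dt + (T/X + 1)(1/H + 1/P + log P/log Q)`."  Here:

* `mem_mul_prime_iff_of_gt`, `aCoef_mul_prime_of_gt` — for a prime `p > Q_J` (in none of the intervals
  `[P_i, Q_i]`, `i ≤ J`) and `p ∤ m`: `mp ∈ 𝒮 ↔ m ∈ 𝒮`, hence `a_{mp} = a_m f(p)`, the factorisation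
  hypothesis of Lemma 12 with `b = a`;
* `integral_Uset_le_lemma12` — Lemma 12 (`MatomakiRadziwillLemma12.lemma12_bound`, `C₁₂ = 20000`) on
  `𝒰` for any parameters `Q_J < P' ≤ Q'`, `P' ≥ 1`, `H' ≥ 1` (the paper's choice above is made in the
  final assembly, where `Q_J ≤ exp(√log X) < exp((log X)^{47/48}) = P'`);
* `card_Icc_filter_forall_not_dvd_le` — the sieve bound behind "`∑_{(n,𝒫)=1} |a_n|²/n ≪ log P/log Q`":
  an absolute `K > 0` with `#{X ≤ n ≤ 2X : p ∤ n for all primes P' ≤ p ≤ Q'} ≤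
  K ((X+1) e^{6/log P'} log P'/log Q' + (Q'+1)^{10})` for `X ≥ 1`, `2 ≤ P' ≤ Q'`, from the tree's
  upper-bound beta sieve (`SieveSequence.sifted_le_of_dvd_primesProdBelow`, dimension `1`, sequence
  `1_{n > ⌈X⌉-1}`, sifting set `∏_{P'≤p≤Q'} p ∣ P(Q'+1)`, level `(Q'+1)^{10}`, `|R_d| ≤ 2`) and Mertens'
  interval product (`LFunctions.MertensBound.prod_one_sub_inv_prime_Icc_le`), exactly as
  `card_rough_Ioc_le` of `BrunTitchmarshShortInterval.lean`;
* `coprime_sum_le_card_div` — `∑_{(n,𝒫)=1} |a_n|²/n ≤ (1/X) · #{…}`.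

What remains for §8.3 (later files): the discretisation of `∫_𝒰 |Q_{v,H} R_{v,H}|²` into well-spaced
points, the count of those points (Lemma 8, sharp form `MatomakiRadziwill2016_lemma8_sharp`), the small
values of `Q_{v,H}` (Lemma 9) and the large ones (Lemmas 11, 3, 5, Brun–Titchmarsh).

## References

* K. Matomäki, M. Radziwiłł, *Multiplicative functions in short intervals*, Ann. of Math. (2) 183
  (2016), 1015–1056, doi:10.4007/annals.2016.183.3.6, arXiv:1501.04585: §8.3 (arXiv p. 17).
-/

noncomputable section

open Finset Complex MeasureTheory

namespace Literature.NumberTheory.Sieve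

namespace SieveIntervalSystem

variable {η X : ℝ} (I : SieveIntervalSystem η X)

/-! ### The second application of Lemma 12: primes beyond `Q_J` do not interact with `𝒮` -/

/-- For a prime `p > Q_J` (so `p` lies in none of the intervals `[P_i, Q_i]`, `i ≤ J`) and `m ≠ 0`:
`mp ∈ 𝒮 ↔ m ∈ 𝒮`. [cite: MatomakiRadziwillAnnals2016, §8.3] -/
theorem mem_mul_prime_iff_of_gt (hη : 0 < η) (hη' : η ≤ 8) {m p : ℕ} (hm : m ≠ 0) (hp : p.Prime)
    (hpQ : I.Q I.J < p) : I.Mem (m * p) ↔ I.Mem m := by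
  have hpf : (m * p).primeFactors = m.primeFactors ∪ {p} := by
    rw [Nat.primeFactors_mul hm hp.ne_zero, hp.primeFactors]
  have hnot : ∀ i ∈ Icc 1 I.J, ¬ (I.P i ≤ (p : ℝ) ∧ (p : ℝ) ≤ I.Q i) := by
    intro i hi ⟨_, h2⟩
    rw [mem_Icc] at hi
    have hQi : I.Q i ≤ I.Q I.J := by
      rcases eq_or_lt_of_le hi.2 with h | h
      · rw [h]
      · exact (I.Q_lt_Q hη hη' hi.1 h).le
    linarith
  constructor
  · intro h i hi
    obtain ⟨q, hq, hqi⟩ := h i hi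
    rw [hpf, mem_union, mem_singleton] at hq
    rcases hq with hq | rfl
    · exact ⟨q, hq, hqi⟩
    · exact (hnot i hi hqi).elim
  · intro h i hi
    obtain ⟨q, hq, hqi⟩ := h i hi
    refine ⟨q, ?_, hqi⟩
    rw [hpf, mem_union]
    exact Or.inl hq

/-- **The factorisation for the second application of Lemma 12** (§8.3: "`a_m = b_m = f(m) 1_𝒮(m)`,
`c_p = f(p)` and `P = exp((log X)^{1-1/48})`"): for primes `p ∈ [P', Q']` with `P' > Q_J` and `p ∤ m`,
`a_{mp} = a_m f(p)`. [cite: MatomakiRadziwillAnnals2016, §8.3] -/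
theorem aCoef_mul_prime_of_gt (hη : 0 < η) (hη' : η ≤ 8) {f : ArithmeticFunction ℝ}
    (hf : f.IsMultiplicative) {P' Q' : ℝ} (hP' : I.Q I.J < P') :
    ∀ m p : ℕ, p.Prime → P' ≤ p → (p : ℝ) ≤ Q' → ¬ p ∣ m →
      I.aCoef f (m * p) = I.aCoef f m * ((f p : ℝ) : ℂ) := by
  intro m p hp hPp _ hpm
  have hm : m ≠ 0 := by rintro rfl; exact hpm (dvd_zero p)
  have hcop : Nat.Coprime m p := (Nat.Prime.coprime_iff_not_dvd hp).2 hpm |>.symm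
  unfold aCoef
  rw [hf.map_mul_of_coprime hcop]
  have hiff := I.mem_mul_prime_iff_of_gt hη hη' hm hp (hP'.trans_le hPp)
  by_cases h : I.Mem m
  · rw [if_pos (hiff.2 h), if_pos h]; push_cast; ring
  · rw [if_neg (fun h' => h (hiff.1 h')), if_neg h, zero_mul]

/-- **Lemma 12 on `𝒰`** (§8.3, first display): for parameters `Q_J < P' ≤ Q'`, `1 ≤ P'`, `H' ≥ 1`,
`X, T ≥ 1`, `T₀ ≥ 0`, with `C₁₂ = 20000`, `a = b = f 1_𝒮`, `c = f`:
`∫_𝒰 |F(1+it)|² ≤ C₁₂ (H' log(Q'/P') ∑_{v} ∫_𝒰 |Q_{v,H'} R_{v,H'}|²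
  + (T+X)/X (1/H' + 1/P' + ∑_{X≤n≤2X, (n,∏_{P'≤p≤Q'} p)=1} |a_n|²/n))`.
[cite: MatomakiRadziwillAnnals2016, §8.3] -/
theorem integral_Uset_le_lemma12 (hη : 0 < η) (hη' : η ≤ 8) (f : ArithmeticFunction ℝ)
    (hf : f.IsMultiplicative) (hf1 : ∀ n, |f n| ≤ 1) (hX : 1 ≤ X) {T₀ T : ℝ} (hT₀ : 0 ≤ T₀)
    (hT : 1 ≤ T) {P' Q' H' : ℝ} (hP'1 : 1 ≤ P') (hP'Q' : P' ≤ Q') (hH' : 1 ≤ H')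
    (hJP' : I.Q I.J < P') :
    ∫ t in I.Uset (fun p => ((f p : ℝ) : ℂ)) T₀ T,
        ‖∑ n ∈ (Icc ⌈X⌉₊ ⌊2 * X⌋₊).filter I.Mem,
            (f n : ℂ) * (n : ℂ) ^ (-(1 + (t : ℂ) * Complex.I))‖ ^ 2 ≤
      20000 * ((H' * Real.log (Q' / P')) *
          (∑ v ∈ Icc ⌊H' * Real.log P'⌋₊ ⌊H' * Real.log Q'⌋₊,
            ∫ t in I.Uset (fun p => ((f p : ℝ) : ℂ)) T₀ T,
              ‖blockPrimePoly (fun p => ((f p : ℝ) : ℂ)) P' Q' H' v t *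
                blockCofactorPoly (I.aCoef f) X P' Q' H' v t‖ ^ 2)
        + (T + X) / X * (1 / H' + 1 / P'
            + ∑ n ∈ (Icc ⌈X⌉₊ ⌊2 * X⌋₊).filter
                (fun n : ℕ => ∀ p ∈ (Icc ⌈P'⌉₊ ⌊Q'⌋₊).filter Nat.Prime, ¬ p ∣ n),
                ‖I.aCoef f n‖ ^ 2 / n)) := by
  have hsub : I.Uset (fun p => ((f p : ℝ) : ℂ)) T₀ T ⊆ Set.Icc (-T) T :=
    (I.Uset_subset _ T₀ T).trans (Set.Icc_subset_Icc (by linarith) le_rfl)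
  have h := MatomakiRadziwillLemma12.lemma12_bound X T P' Q' H' (I.aCoef f) (I.aCoef f)
    (fun p => ((f p : ℝ) : ℂ)) (I.Uset (fun p => ((f p : ℝ) : ℂ)) T₀ T) hX hT hP'1 hP'Q' hH'
    (I.norm_aCoef_le hf1) (I.norm_aCoef_le hf1) (norm_cCoef_le hf1)
    (I.aCoef_mul_prime_of_gt hη hη' hf hJP') hsub
  simp only [I.sum_aCoef_eq] at h
  exact h

end SieveIntervalSystem

/-! ### The sieve term of the second application of Lemma 12 -/

/-- **Integers in `[X, 2X]` free of prime factors from `[P', Q']`** (the "`∑_{(n,𝒫)=1}|a_n|²/n ≪ log P/log Q`"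
of §8.3, via the upper-bound beta sieve): there is an absolute `K > 0` with
`#{X ≤ n ≤ 2X : p ∤ n for all primes P' ≤ p ≤ Q'} ≤ K ((X + 1) e^{6/log P'} log P'/log Q' + (Q'+1)^{10})`
for all `X ≥ 1`, `2 ≤ P' ≤ Q'`.  Proof as in `card_rough_Ioc_le` (`BrunTitchmarshShortInterval.lean`):
`SieveSequence.sifted_le_of_dvd_primesProdBelow` in dimension `1` for `a_n = 1_{n > ⌈X⌉-1}`, sifting set
`∏_{P' ≤ p ≤ Q'} p ∣ P(Q'+1)`, level `D = (Q'+1)^{10}`, `|R_d| ≤ 2`, and Mertens' interval product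
`∏_{P' ≤ p ≤ Q'}(1 - 1/p) ≤ e^{6/log P'} log P'/log Q'` (`LFunctions.MertensBound.prod_one_sub_inv_prime_Icc_le`).
[cite: MatomakiRadziwillAnnals2016, §8.3]; the sieve bound itself is [folklore]. -/
theorem card_Icc_filter_forall_not_dvd_le :
    ∃ K : ℝ, 0 < K ∧ ∀ X P' Q' : ℝ, 1 ≤ X → 2 ≤ P' → P' ≤ Q' →
      (#((Icc ⌈X⌉₊ ⌊2 * X⌋₊).filter
          (fun n : ℕ => ∀ p ∈ (Icc ⌈P'⌉₊ ⌊Q'⌋₊).filter Nat.Prime, ¬ p ∣ n)) : ℝ) ≤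
        K * ((X + 1) * (Real.exp (6 / Real.log P') * (Real.log P' / Real.log Q')) + (Q' + 1) ^ (10 : ℕ)) := by
  obtain ⟨K₀, hK₀⟩ := hasSieveDimension_reciprocalDensity_one_holds
  have hK₀1 : 1 ≤ K₀ := hK₀.one_le
  refine ⟨1 + 2 * K₀ ^ (10 : ℕ), by positivity, fun X P' Q' hX hP' hP'Q' => ?_⟩
  classical
  set z : ℝ := Q' + 1 with hz_def
  have hz : 2 ≤ z := by rw [hz_def]; linarith
  have hz1 : 1 < z := by linarith
  have hz0 : 0 < z := by linarith
  have hlogz : 0 < Real.log z := Real.log_pos hz1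
  have hX0 : 0 < X := by linarith
  -- the interval as `(N, N + M]`
  set N : ℕ := ⌈X⌉₊ - 1 with hN
  have hceil1 : 1 ≤ ⌈X⌉₊ := Nat.one_le_iff_ne_zero.2 (Nat.ceil_pos.2 hX0).ne'
  have hcf : ⌈X⌉₊ ≤ ⌊2 * X⌋₊ + 1 := by
    have h1 : (⌈X⌉₊ : ℝ) < X + 1 := Nat.ceil_lt_add_one hX0.le
    have h2 : 2 * X < (⌊2 * X⌋₊ : ℝ) + 1 := Nat.lt_floor_add_one _
    have : (⌈X⌉₊ : ℝ) < (⌊2 * X⌋₊ : ℝ) + 1 + 1 := by linarith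
    exact_mod_cast Nat.lt_succ_iff.1 (by exact_mod_cast this)
  set M : ℕ := ⌊2 * X⌋₊ + 1 - ⌈X⌉₊ with hM
  have hNM : N + M = ⌊2 * X⌋₊ := by omega
  have hMle : (M : ℝ) ≤ X + 1 := by
    rw [hM, Nat.cast_sub hcf]
    push_cast
    linarith [Nat.floor_le (show 0 ≤ 2 * X by positivity), Nat.le_ceil X]
  -- the sifted sequence
  let A : SieveSequence :=
    { a := fun n => if N < n then 1 else 0
      a_nonneg := fun n => by
        split_ifs
        · exact zero_le_one
        · exact le_rfl
      size := fun y => y - N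
      density := reciprocalDensity
      density_mult := isMultiplicative_reciprocalDensity }
  have hAa : ∀ n, A.a n = if N < n then 1 else 0 := fun n => rfl
  have hsize : ∀ y, A.size y = y - N := fun y => rfl
  have hdens : A.density = reciprocalDensity := rfl
  -- the sifting set `P = ∏_{P' ≤ p ≤ Q'} p ∣ P(z)` and the level `D = z^{10}`
  set Ps := (Icc ⌈P'⌉₊ ⌊Q'⌋₊).filter Nat.Prime with hPs
  have hPsprime : ∀ p ∈ Ps, p.Prime := fun p hp => (Finset.mem_filter.1 hp).2
  set P : ℕ := ∏ p ∈ Ps, p with hPdef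
  have hPdvd : P ∣ primesProdBelow z := by
    refine Finset.prod_dvd_prod_of_subset _ _ _ fun p hp => ?_
    rw [Finset.mem_filter, Finset.mem_Icc] at hp
    rw [Nat.mem_primesBelow]
    refine ⟨Nat.lt_ceil.2 ?_, hp.2⟩
    have : (p : ℝ) ≤ Q' := (Nat.le_floor_iff (by linarith)).1 hp.1.2
    rw [hz_def]; linarith
  set D : ℝ := z ^ (10 : ℕ) with hD
  set x : ℝ := ((N + M : ℕ) : ℝ) with hx
  have hxfloor : ⌊x⌋₊ = N + M := by rw [hx, Nat.floor_natCast]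
  have hdim : HasSieveDimension A.density 1 K₀ := hK₀
  have hD1 : 1 < D := one_lt_pow₀ hz1 (by norm_num)
  have hzD : (9 * (1 : ℝ) + 1) * Real.log z ≤ Real.log D := by
    rw [hD, Real.log_pow]; norm_num
  have hXsz : 0 ≤ A.size x := by
    rw [hsize, hx]; push_cast; linarith
  have hsieve := SieveSequence.sifted_le_of_dvd_primesProdBelow hdim one_pos hz hD1 hzD hXsz hPdvd
  have hexp : Real.exp ((9 * (1 : ℝ) + 1) - Real.log D / Real.log z) = 1 := by
    rw [hD, Real.log_pow, Nat.cast_ofNat, mul_div_assoc, div_self hlogz.ne']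
    norm_num
  rw [hexp, mul_one] at hsieve
  -- the set to count is inside the sifted set
  have hcount : (#((Icc ⌈X⌉₊ ⌊2 * X⌋₊).filter
      (fun n : ℕ => ∀ p ∈ (Icc ⌈P'⌉₊ ⌊Q'⌋₊).filter Nat.Prime, ¬ p ∣ n)) : ℝ) ≤ A.sifted x P := by
    rw [A.sifted_eq_card {n : ℕ | N < n} (fun n => by rw [hAa]; rfl) x P, hxfloor]
    have hsub : (Icc ⌈X⌉₊ ⌊2 * X⌋₊).filter
        (fun n : ℕ => ∀ p ∈ (Icc ⌈P'⌉₊ ⌊Q'⌋₊).filter Nat.Prime, ¬ p ∣ n) ⊆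
        (Ioc 0 (N + M)).filter (fun n : ℕ => n ∈ {n : ℕ | N < n} ∧ n.Coprime P) := by
      intro n hn
      rw [Finset.mem_filter, Finset.mem_Icc] at hn
      rw [Finset.mem_filter, Finset.mem_Ioc, Set.mem_setOf_eq]
      refine ⟨⟨by omega, by omega⟩, by omega, ?_⟩
      rw [hPdef]
      exact Nat.Coprime.prod_right fun p hp =>
        (Nat.coprime_comm.2 ((hPsprime p hp).coprime_iff_not_dvd.2 (hn.2 p hp)))
    exact_mod_cast Finset.card_le_card hsub
  -- main term: `X V(P) ≤ (X + 1) e^{6/log P'} log P'/log Q'`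
  have hmain : A.size x * A.densityProduct P ≤
      (X + 1) * (Real.exp (6 / Real.log P') * (Real.log P' / Real.log Q')) := by
    rw [hsize, hx]
    have hV : A.densityProduct P = ∏ p ∈ Ps, (1 - (p : ℝ)⁻¹) := by
      rw [SieveSequence.densityProduct, hdens, hPdef, Nat.primeFactors_prod hPsprime]
      rfl
    rw [hV]
    have hM' : ((N + M : ℕ) : ℝ) - N = M := by push_cast; ring
    rw [hM']
    have hprod := Literature.NumberTheory.LFunctions.MertensBound.prod_one_sub_inv_prime_Icc_le hP' hP'Q'
    have hprod0 : 0 ≤ ∏ p ∈ Ps, (1 - (p : ℝ)⁻¹) :=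
      Finset.prod_nonneg fun p hp => by
        have : (2 : ℝ) ≤ p := by exact_mod_cast (hPsprime p hp).two_le
        rw [sub_nonneg]; exact inv_le_one_of_one_le₀ (by linarith)
    exact mul_le_mul hMle hprod hprod0 (by linarith)
  -- remainders: `|R_d(x)| ≤ 2`
  have hrem1 : ∀ d : ℕ, 0 < d → |A.remainder d x| ≤ 2 := by
    intro d hd
    have hcongr : A.congrSum d x = #((Ioc N (N + M)).filter (fun n : ℕ => d ∣ n)) := by
      rw [SieveSequence.congrSum, hxfloor]
      simp only [hAa, Finset.sum_boole, Finset.filter_filter]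
      congr 2
      ext n
      simp only [Finset.mem_filter, Finset.mem_Ioc]
      omega
    rw [SieveSequence.remainder, hcongr, hdens, reciprocalDensity_apply, hsize, hx]
    have hM' : ((N + M : ℕ) : ℝ) - N = M := by push_cast; ring
    rw [hM', inv_mul_eq_div]
    exact abs_card_Ioc_filter_dvd_sub_le hd N M
  have hrem : ∑ d ∈ P.divisors.filter (fun d : ℕ => (d : ℝ) ≤ D), |A.remainder d x| ≤ 2 * D := by
    calc ∑ d ∈ P.divisors.filter (fun d : ℕ => (d : ℝ) ≤ D), |A.remainder d x|
        ≤ ∑ d ∈ P.divisors.filter (fun d : ℕ => (d : ℝ) ≤ D), (2 : ℝ) := by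
          refine Finset.sum_le_sum fun d hd => ?_
          obtain ⟨hd, -⟩ := Finset.mem_filter.1 hd
          exact hrem1 d (Nat.pos_of_mem_divisors hd)
      _ = 2 * #(P.divisors.filter (fun d : ℕ => (d : ℝ) ≤ D)) := by
          rw [Finset.sum_const, nsmul_eq_mul, mul_comm]
      _ ≤ 2 * #(Icc 1 ⌊D⌋₊) := by
          gcongr
          intro d hd
          obtain ⟨hd, hdD⟩ := Finset.mem_filter.1 hd
          rw [Finset.mem_Icc]
          exact ⟨Nat.pos_of_mem_divisors hd, Nat.le_floor hdD⟩
      _ ≤ 2 * D := by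
          rw [Nat.card_Icc, Nat.add_sub_cancel]
          exact mul_le_mul_of_nonneg_left (Nat.floor_le (by positivity)) (by norm_num)
  -- assemble
  have hK : (0 : ℝ) ≤ 1 + 2 * K₀ ^ (10 : ℕ) := by positivity
  have h2 : (2 : ℝ) ≤ 1 + 2 * K₀ ^ (10 : ℕ) := by
    have : (1 : ℝ) ≤ K₀ ^ (10 : ℕ) := one_le_pow₀ hK₀1
    linarith
  calc (#((Icc ⌈X⌉₊ ⌊2 * X⌋₊).filter
        (fun n : ℕ => ∀ p ∈ (Icc ⌈P'⌉₊ ⌊Q'⌋₊).filter Nat.Prime, ¬ p ∣ n)) : ℝ)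
      ≤ A.sifted x P := hcount
    _ ≤ (1 + 2 * K₀ ^ (10 : ℕ)) * (A.size x * A.densityProduct P) +
          ∑ d ∈ P.divisors.filter (fun d : ℕ => (d : ℝ) ≤ D), |A.remainder d x| := hsieve
    _ ≤ (1 + 2 * K₀ ^ (10 : ℕ)) * ((X + 1) * (Real.exp (6 / Real.log P') * (Real.log P' / Real.log Q'))) +
          2 * D := add_le_add (mul_le_mul_of_nonneg_left hmain hK) hrem
    _ ≤ (1 + 2 * K₀ ^ (10 : ℕ)) * ((X + 1) * (Real.exp (6 / Real.log P') * (Real.log P' / Real.log Q'))) +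
          (1 + 2 * K₀ ^ (10 : ℕ)) * D := by
        have hD0 : (0 : ℝ) ≤ D := by positivity
        nlinarith [mul_le_mul_of_nonneg_right h2 hD0]
    _ = (1 + 2 * K₀ ^ (10 : ℕ)) *
          ((X + 1) * (Real.exp (6 / Real.log P') * (Real.log P' / Real.log Q')) + (Q' + 1) ^ (10 : ℕ)) := by
        rw [hD, hz_def]; ring

namespace SieveIntervalSystem

variable {η X : ℝ} (I : SieveIntervalSystem η X)

/-- The sieve term of Lemma 12 on `𝒰`: `∑_{X≤n≤2X, (n,𝒫)=1} |a_n|²/n ≤ (1/X) #{X ≤ n ≤ 2X : (n, 𝒫) = 1}`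
(`|a_n| ≤ 1`, `n ≥ X`). [folklore] -/
theorem coprime_sum_le_card_div {f : ℕ → ℝ} (hf1 : ∀ n, |f n| ≤ 1) (hX : 0 < X) (P' Q' : ℝ) :
    ∑ n ∈ (Icc ⌈X⌉₊ ⌊2 * X⌋₊).filter
        (fun n : ℕ => ∀ p ∈ (Icc ⌈P'⌉₊ ⌊Q'⌋₊).filter Nat.Prime, ¬ p ∣ n), ‖I.aCoef f n‖ ^ 2 / n ≤
      (#((Icc ⌈X⌉₊ ⌊2 * X⌋₊).filter
          (fun n : ℕ => ∀ p ∈ (Icc ⌈P'⌉₊ ⌊Q'⌋₊).filter Nat.Prime, ¬ p ∣ n)) : ℝ) * (1 / X) := by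
  rw [← nsmul_eq_mul, ← sum_const]
  refine sum_le_sum fun n hn => ?_
  have hXn : X ≤ n := Nat.ceil_le.1 (mem_Icc.1 (mem_filter.1 hn).1).1
  have hn0 : (0 : ℝ) < n := hX.trans_le hXn
  have h1 : ‖I.aCoef f n‖ ^ 2 ≤ 1 := by
    have := I.norm_aCoef_le hf1 n
    have h0 := norm_nonneg (I.aCoef f n)
    nlinarith only [this, h0]
  calc ‖I.aCoef f n‖ ^ 2 / n ≤ 1 / (n : ℝ) := div_le_div_of_nonneg_right h1 hn0.le
    _ ≤ 1 / X := div_le_div_of_nonneg_left zero_le_one hX hXn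

end SieveIntervalSystem

end Literature.NumberTheory.Sieve
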